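import Literature.MathematicalPhysics.QuantumFieldTheory.Balaban1983to89.B9Thm37GlueCor36
import Literature.MathematicalPhysics.QuantumFieldTheory.Balaban1983to89.B9Thm314

/-!
# `Balaban1983to89.B9Thm314SupReading` — [Balaban1985BackgroundPropagators] Theorem 3.14 (pp. 426–427, (3.154)): the SUP-ENTRY readings
# `B9.Thm314Printed` (leaf field `t314`) and `B9Thm314.Thm314SupOn` (the sup part of the leaf field `t314loc`) FROM [4]-type block majorants of
# model operators under the cell's co-reading schema — the last link of the resolvent route, carrier-free

B9 = T. Bałaban, *Propagators for lattice gauge theories in a background field*, Commun. Math. Phys. **99** (1985) 389–434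
[Balaban1985BackgroundPropagators]; [4] = [Balaban1984PropagatorsII], (2.51) p. 232.  DAG node N06 ([B9]), seat `pub-ymgap-dag-n06-a` (KNIT-BY-NAME),
design note `HOME/pub-ymgap-dag-n06-a/B9-PIN-DESIGN-g2.md` §8 (t314 route of record).  Count-neutral; nothing of Bałaban's is asserted.

WHY.  The leaf of record `DagBinding.B9LeafX Y` carries Theorem 3.14 twice: `numbered.t314 : B9.Thm314Printed …` (sup entries, no localisation
restriction) and `t314loc : B9Thm314.Thm314LocalPrinted …` (sup + L² + Hölder entries for y, y′ ∈ Ω^{(k)}).  The seat's resolvent toolkit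
(`B9Thm314ResolventCore ∕ …Weighted ∕ …TwoMetric ∕ …TwoMetricWeighted ∕ B9Thm314ExtraFactor ∕ B6MajorantReblock ∕ B9Thm314Combine`) ends in the currency of
[4]'s block majorants — `B6RandomWalk.HasMajorant blk T (fun a b => C·w(a)·e^{−δ₁d(a,b)}·e^{−δ₂F(a,b)})` for the model difference operator `T` — while the
leaf fields are typed over the abstract observation quantities `B9.KernelFamily.e n U λ y` (p. 397 (3.39)∕(3.42): the sup over x ∈ Δ(y) of the n-th
entry).  The cell's CO-READING schema `B9Thm37GlueCor36.CoRealizes K n U bu bv ev A` (pv21; «e_n is below every common bound of |A(ev λ)| on the block»)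
is exactly the hypothesis under which a majorant of the model operator `A` becomes the typed inequality; this module performs that step WITH THE
ADDITIONAL FACTOR exp(−δ₀d(y, y′, Ω)) of (3.154) and assembles the two leaf-level statements with the printed quantifier prefix
(constants BEFORE the member i and the configuration U; thresholds `M₅ ≤ M`, `Mα₀ ≤ a₀`, (3.35)).

WHAT IS PROVED (kernel; theorems only; every analytic input displayed):
* §1 `entry_le_of_hasMajorantHom` — ONE entry, ONE configuration: co-reading + the two-space majorant (`B6RandomWalkHom.HasMajorantHom` over the transport
  `B9Thm34Ext.toB6`) with kernel `C·[(Lʲη)², Lʲη, Lʲη, 1]_n·e^{−δ₁d}·e^{−δ₂F}` ⇒ the n-th sup inequality with that right-hand side (two rates);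
  `le_merge_rates` — (C, δ₁, δ₂) ↦ (B₀, δ₀, δ₀) for C ≤ B₀, δ₀ ≤ min(δ₁, δ₂) when d, F ≥ 0 (print: «after adjusting a definition of δ₀», p. 427);
  `ineqSupF_of_hasMajorantHom` — all four entries ⇒ `B9Thm314.IneqSupF K B₀ δ₀ P (e^{−δ₀F}) U` for EVERY restriction `P` (a restriction only weakens).
* §2 `thm314SupOn_of_hasMajorantHom` ∕ `thm314Printed_of_hasMajorantHom` — the FAMILY statements `B9Thm314.Thm314SupOn c35 geo bg Kdiff OmK dOmega` and
  `B9.Thm314Printed c35 geo bg Kdiff dOmega` from: a co-reading of every entry of `Kdiff i` at every U by model operators `A i n U`, and majorants of those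
  operators with ONE constant C and rates δ₁ (characteristic) ∕ δ₂ (additional) for all members above the threshold and all regular U; δ₀ := min(δ₁, δ₂).
* §3 `hasMajorantHom_of_hasMajorant_entry` — the toolkit's one-lattice output shape (`HasMajorant`, entries 0 and 3; weight `w := pref4 (len ·) n`) IS the §2
  hypothesis shape (`B6RandomWalkHom.hasMajorantHom_iff`); for the two-lattice entries 1, 2 (∇_U G′, G′∇*_U) the engines run on the sum lattice and descend by
  `B6RandomWalkHom.hasMajorantHom_of_emb` (recorded, not redone).
HONEST SCOPE: bookkeeping between two typings; the L² ∕ Hölder parts of `Thm314LocalPrinted` are NOT produced here (they need the corresponding readings of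
`KernelFamily.l2 ∕ h1 ∕ e4 ∕ h2`, not in the tree); the majorants themselves are the pin's obligations (design §8 (1)–(6)).  One finite lattice programme;
NOT continuum ∕ OS ∕ mass gap ∕ Clay.
-/

namespace Literature.MathematicalPhysics.QuantumFieldTheory.Balaban1983to89.B9Thm314SupReading

open Literature.MathematicalPhysics.QuantumFieldTheory.Balaban1983to89
open B6RandomWalk B6RandomWalkHom B9Thm34Ext B9Thm37GlueCor36

/-! ## §1 One configuration: the sup entries with the additional factor, from two-space majorants under the co-reading -/

section OneCfg

variable {g : B9.Geometry} [Fintype g.Site] {R : ℝ} {H : Prop} {B : B9.Backgrounds}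

omit [Fintype g.Site] in
/-- The two-factor kernel `C·[(Lʲη)², Lʲη, Lʲη, 1]_n·e^{−δ₁d(a,b)}·e^{−δ₂F(a,b)}` is nonnegative for C ≥ 0, Lʲη ≥ 0. [folklore] -/
private theorem kernel_nonneg {C δ₁ δ₂ : ℝ} (hC : 0 ≤ C) (hlen : ∀ y, 0 ≤ g.len y) (n : Fin 4) (Fd : g.Site → g.Site → ℝ)
    (a b : g.Site) :
    0 ≤ C * B9.pref4 (g.len a) n * Real.exp (-(δ₁ * g.dist a b)) * Real.exp (-(δ₂ * Fd a b)) :=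
  mul_nonneg (mul_nonneg (mul_nonneg hC (B9SectCDiffDict.pref4_nonneg (hlen a) n)) (Real.exp_nonneg _))
    (Real.exp_nonneg _)

/-- **ONE ENTRY of Theorem 3.14's sup inequalities from a majorant.**  If the n-th observation quantity of `K` at `U` is co-read by the model
operator `A` (`CoRealizes`, p. 397 (3.39)∕(3.42)) and `A` has the [4]-(2.51) majorant `C·[(Lʲη)², Lʲη, Lʲη, 1]_n·e^{−δ₁d(y,y′)}·e^{−δ₂F(y,y′)}`, then
`e_n(U, λ, y) ≤ C·[…]_n·e^{−δ₁d(y,y′)}·e^{−δ₂F(y,y′)}·|λ|` for supp λ ⊂ Δ(y′) — the n-th inequality of (3.42) «with the additional factor» (3.154), at two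
rates. [cite: Balaban1985BackgroundPropagators, Thm 3.14 (3.154) pp.426–427 + (3.42) p.397 (bookkeeping under the co-reading)] -/
theorem entry_le_of_hasMajorantHom {K : B9.KernelFamily g B} {n : Fin 4} {U : B.Cfg} {u v : Type}
    {bu : u → g.Site} {bv : v → g.Site} {ev : g.Loc → v → ℝ} {A : (v → ℝ) →ₗ[ℝ] (u → ℝ)}
    (hco : CoRealizes K n U bu bv ev A) {C δ₁ δ₂ : ℝ} {Fd : g.Site → g.Site → ℝ}
    (hA : HasMajorantHom (g := toB6 g R H) bv bu A
      (fun a b => C * B9.pref4 (g.len a) n * Real.exp (-(δ₁ * g.dist a b)) * Real.exp (-(δ₂ * Fd a b))))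
    (hC : 0 ≤ C) (hlen : ∀ y, 0 ≤ g.len y) :
    ∀ (lam : g.Loc) (y y' : g.Site), g.suppIn lam y' →
      K.e n U lam y ≤ C * B9.pref4 (g.len y) n * Real.exp (-(δ₁ * g.dist y y')) * Real.exp (-(δ₂ * Fd y y')) *
        g.supNorm lam :=
  le_of_hasMajorantHom_of_coRealizes hco (fun a b => kernel_nonneg hC hlen n Fd a b) hA

omit [Fintype g.Site] in
/-- **Merging constants and rates** («after adjusting a definition of δ₀», p. 427): a bound with constant C ≤ B₀ (C ≥ 0) and rates δ₁ on d ≥ 0,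
δ₂ on F ≥ 0 implies the bound with the single pair (B₀, δ₀) for any δ₀ ≤ min(δ₁, δ₂) — Theorem 3.14 prints ONE δ₀ for both factors.
[cite: Balaban1985BackgroundPropagators, Thm 3.14 proof p.427 («after adjusting a definition of δ₀»; bookkeeping arithmetic)] -/
theorem le_merge_rates {e C B₀ δ₁ δ₂ δ₀ p d F s : ℝ}
    (h : e ≤ C * p * Real.exp (-(δ₁ * d)) * Real.exp (-(δ₂ * F)) * s)
    (hC : 0 ≤ C) (hCB : C ≤ B₀) (h₁ : δ₀ ≤ δ₁) (h₂ : δ₀ ≤ δ₂) (hp : 0 ≤ p) (hd : 0 ≤ d) (hF : 0 ≤ F)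
    (hs : 0 ≤ s) :
    e ≤ B₀ * p * Real.exp (-(δ₀ * d)) * Real.exp (-(δ₀ * F)) * s := by
  refine h.trans ?_
  have e1 : Real.exp (-(δ₁ * d)) ≤ Real.exp (-(δ₀ * d)) :=
    Real.exp_le_exp.2 (neg_le_neg (mul_le_mul_of_nonneg_right h₁ hd))
  have e2 : Real.exp (-(δ₂ * F)) ≤ Real.exp (-(δ₀ * F)) :=
    Real.exp_le_exp.2 (neg_le_neg (mul_le_mul_of_nonneg_right h₂ hF))
  have hBp : 0 ≤ B₀ * p := mul_nonneg (hC.trans hCB) hp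
  refine mul_le_mul_of_nonneg_right ?_ hs
  exact mul_le_mul (mul_le_mul (mul_le_mul_of_nonneg_right hCB hp) e1 (Real.exp_nonneg _) hBp) e2
    (Real.exp_nonneg _) (mul_nonneg hBp (Real.exp_nonneg _))

/-- **ALL FOUR SUP ENTRIES AT ONE CONFIGURATION** ⇒ `B9Thm314.IneqSupF K B₀ δ₀ P (e^{−δ₀F}) U` — the sup block of Theorem 3.14 for one U, with an
arbitrary localisation restriction `P` (printed: y, y′ ∈ Ω^{(k)}; unrestricted majorants serve every `P`).  Entry n is co-read by the model operator
`A n` between the lattices `v n → u n` (n = 0: G′-type, sites → sites; n = 1: ∇_U G′, sites → bonds; n = 2: G′∇*_U, bonds → sites; n = 3: Δ_U G′) and each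
`A n` carries the majorant `C·[…]_n·e^{−δ₁d}·e^{−δ₂F}`; constants merge by `le_merge_rates`.
[cite: Balaban1985BackgroundPropagators, Thm 3.14 (3.154) pp.426–427 (bookkeeping under the co-reading)] -/
theorem ineqSupF_of_hasMajorantHom {K : B9.KernelFamily g B} {U : B.Cfg} {u v : Fin 4 → Type}
    {bu : ∀ n, u n → g.Site} {bv : ∀ n, v n → g.Site} {ev : ∀ n, g.Loc → v n → ℝ}
    {A : ∀ n, (v n → ℝ) →ₗ[ℝ] (u n → ℝ)} (hco : ∀ n, CoRealizes K n U (bu n) (bv n) (ev n) (A n))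
    {C B₀ δ₁ δ₂ δ₀ : ℝ} {Fd : g.Site → g.Site → ℝ}
    (hA : ∀ n, HasMajorantHom (g := toB6 g R H) (bv n) (bu n) (A n)
      (fun a b => C * B9.pref4 (g.len a) n * Real.exp (-(δ₁ * g.dist a b)) * Real.exp (-(δ₂ * Fd a b))))
    (hC : 0 ≤ C) (hCB : C ≤ B₀) (h₁ : δ₀ ≤ δ₁) (h₂ : δ₀ ≤ δ₂) (hlen : ∀ y, 0 ≤ g.len y)
    (hdist : ∀ a b, 0 ≤ g.dist a b) (hF : ∀ a b, 0 ≤ Fd a b) (P : g.Site → Prop) :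
    B9Thm314.IneqSupF K B₀ δ₀ P (fun y y' => Real.exp (-(δ₀ * Fd y y'))) U := by
  intro n lam y y' _ _ hs
  exact le_merge_rates (entry_le_of_hasMajorantHom (hco n) (hA n) hC hlen lam y y' hs) hC hCB h₁ h₂
    (B9SectCDiffDict.pref4_nonneg (hlen y) n) (hdist y y') (hF y y') ((hco n).norm_nonneg lam)

end OneCfg

/-! ## §2 The family statements: `Thm314SupOn` (sup part of the leaf field `t314loc`) and `B9.Thm314Printed` (the leaf field `t314`) -/

section Family

variable {I : Type} {c35 : ℝ} {geo : I → B9.Geometry} [hfin : ∀ i, Fintype (geo i).Site] {R : I → ℝ} {Hh : I → Prop}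
  {bg : I → B9.Backgrounds} {Kdiff : ∀ i, B9.KernelFamily (geo i) (bg i)}
  {dOmega : ∀ i, (geo i).Site → (geo i).Site → ℝ}
  {u v : I → Fin 4 → Type} {bu : ∀ i n, u i n → (geo i).Site} {bv : ∀ i n, v i n → (geo i).Site}
  {ev : ∀ i n, (geo i).Loc → v i n → ℝ} {A : ∀ i n, (bg i).Cfg → ((v i n → ℝ) →ₗ[ℝ] (u i n → ℝ))}

/-- **THEOREM 3.14, SUP PART WITH THE LOCALISATION RESTRICTION, FROM MAJORANTS** (pp. 426–427: *«If we take a pair of operators constructed for the two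
sequences {Ω_j}, {Ω′_j}, then their difference satisfies all the inequalities characteristic for operators of the considered type, with the additional factor
exp(−δ₀d(y, y′, Ω))»*).  Hypotheses, all displayed: every entry of the difference family `Kdiff i` at every U is co-read by a model operator `A i n U`
(`hco`); ONE constant C > 0 and rates δ₁, δ₂ > 0 such that for every member above the threshold `M₅ ≤ M`, every `0 < α₀` with `Mα₀ ≤ a₀` and every U in the
class (3.35), each `A i n U` has the [4]-majorant `C·[(Lʲη)², Lʲη, Lʲη, 1]_n·e^{−δ₁d(y,y′)}·e^{−δ₂d(y,y′,Ω)}` (`hmaj` — the output of the resolvent toolkit at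
the pin, design §8); signs of d, d(·,·,Ω), Lʲη.  Conclusion: `B9Thm314.Thm314SupOn` with δ₀ := min(δ₁, δ₂), B₀ := C, for ANY restriction `OmK`.
[cite: Balaban1985BackgroundPropagators, Thm 3.14 (3.154) pp.426–427] -/
theorem thm314SupOn_of_hasMajorantHom
    (hco : ∀ i n U, CoRealizes (Kdiff i) n U (bu i n) (bv i n) (ev i n) (A i n U))
    {M₅ δ₁ δ₂ a₀ C : ℝ} (hM₅ : 0 < M₅) (hδ₁ : 0 < δ₁) (hδ₂ : 0 < δ₂) (ha₀ : 0 < a₀) (hC : 0 < C)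
    (hmaj : ∀ i, M₅ ≤ (geo i).M → ∀ α₀ : ℝ, 0 < α₀ → (geo i).M * α₀ ≤ a₀ →
      ∀ U : (bg i).Cfg, (bg i).Reg335 c35 α₀ U → ∀ n : Fin 4,
        HasMajorantHom (g := toB6 (geo i) (R i) (Hh i)) (bv i n) (bu i n) (A i n U)
          (fun a b => C * B9.pref4 ((geo i).len a) n * Real.exp (-(δ₁ * (geo i).dist a b)) *
            Real.exp (-(δ₂ * dOmega i a b))))
    (hlen : ∀ i y, 0 ≤ (geo i).len y) (hdist : ∀ i a b, 0 ≤ (geo i).dist a b) (hF : ∀ i a b, 0 ≤ dOmega i a b)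
    (OmK : ∀ i, (geo i).Site → Prop) :
    B9Thm314.Thm314SupOn c35 geo bg Kdiff OmK dOmega := by
  refine ⟨M₅, min δ₁ δ₂, a₀, C, hM₅, lt_min hδ₁ hδ₂, ha₀, hC, fun i hMi α₀ hα hMa U hU => ?_⟩
  exact ineqSupF_of_hasMajorantHom (fun n => hco i n U) (hmaj i hMi α₀ hα hMa U hU) hC.le le_rfl
    (min_le_left _ _) (min_le_right _ _) (hlen i) (hdist i) (hF i) (OmK i)

/-- **THEOREM 3.14 AS THE LEAF TYPES IT (`B9.Thm314Printed`, field `B9Leaf.t314`) FROM MAJORANTS** — the same hypotheses, no localisation restriction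
(`B9Thm314.thm314Printed_iff_supOn_univ`). [cite: Balaban1985BackgroundPropagators, Thm 3.14 (3.154) pp.426–427] -/
theorem thm314Printed_of_hasMajorantHom
    (hco : ∀ i n U, CoRealizes (Kdiff i) n U (bu i n) (bv i n) (ev i n) (A i n U))
    {M₅ δ₁ δ₂ a₀ C : ℝ} (hM₅ : 0 < M₅) (hδ₁ : 0 < δ₁) (hδ₂ : 0 < δ₂) (ha₀ : 0 < a₀) (hC : 0 < C)
    (hmaj : ∀ i, M₅ ≤ (geo i).M → ∀ α₀ : ℝ, 0 < α₀ → (geo i).M * α₀ ≤ a₀ →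
      ∀ U : (bg i).Cfg, (bg i).Reg335 c35 α₀ U → ∀ n : Fin 4,
        HasMajorantHom (g := toB6 (geo i) (R i) (Hh i)) (bv i n) (bu i n) (A i n U)
          (fun a b => C * B9.pref4 ((geo i).len a) n * Real.exp (-(δ₁ * (geo i).dist a b)) *
            Real.exp (-(δ₂ * dOmega i a b))))
    (hlen : ∀ i y, 0 ≤ (geo i).len y) (hdist : ∀ i a b, 0 ≤ (geo i).dist a b) (hF : ∀ i a b, 0 ≤ dOmega i a b) :
    B9.Thm314Printed c35 geo bg Kdiff dOmega :=
  B9Thm314.thm314Printed_iff_supOn_univ.2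
    (thm314SupOn_of_hasMajorantHom hco hM₅ hδ₁ hδ₂ ha₀ hC hmaj hlen hdist hF fun _ _ => True)

/-- **Both leaf-level sup statements at once** (what `DagBinding.B9LeafX` asks of Theorem 3.14 in the sup entries: `numbered.t314` and, via
`B9Thm314.supOn_of_local`, the sup part of `t314loc`). [cite: Balaban1985BackgroundPropagators, Thm 3.14 (3.154) pp.426–427] -/
theorem thm314_sup_pair_of_hasMajorantHom
    (hco : ∀ i n U, CoRealizes (Kdiff i) n U (bu i n) (bv i n) (ev i n) (A i n U))
    {M₅ δ₁ δ₂ a₀ C : ℝ} (hM₅ : 0 < M₅) (hδ₁ : 0 < δ₁) (hδ₂ : 0 < δ₂) (ha₀ : 0 < a₀) (hC : 0 < C)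
    (hmaj : ∀ i, M₅ ≤ (geo i).M → ∀ α₀ : ℝ, 0 < α₀ → (geo i).M * α₀ ≤ a₀ →
      ∀ U : (bg i).Cfg, (bg i).Reg335 c35 α₀ U → ∀ n : Fin 4,
        HasMajorantHom (g := toB6 (geo i) (R i) (Hh i)) (bv i n) (bu i n) (A i n U)
          (fun a b => C * B9.pref4 ((geo i).len a) n * Real.exp (-(δ₁ * (geo i).dist a b)) *
            Real.exp (-(δ₂ * dOmega i a b))))
    (hlen : ∀ i y, 0 ≤ (geo i).len y) (hdist : ∀ i a b, 0 ≤ (geo i).dist a b) (hF : ∀ i a b, 0 ≤ dOmega i a b)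
    (OmK : ∀ i, (geo i).Site → Prop) :
    B9.Thm314Printed c35 geo bg Kdiff dOmega ∧ B9Thm314.Thm314SupOn c35 geo bg Kdiff OmK dOmega :=
  ⟨thm314Printed_of_hasMajorantHom hco hM₅ hδ₁ hδ₂ ha₀ hC hmaj hlen hdist hF,
    thm314SupOn_of_hasMajorantHom hco hM₅ hδ₁ hδ₂ ha₀ hC hmaj hlen hdist hF OmK⟩

end Family

/-! ## §3 The toolkit's output shape is the hypothesis shape -/

section Shape

variable {g : B9.Geometry} [Fintype g.Site] {R : ℝ} {H : Prop}

/-- **The one-lattice output of the resolvent toolkit IS the `hmaj` hypothesis of §2** for the endomorphism entries (n = 0: the operator itself, n = 3: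
Δ_U composed with it): `B9Thm314Combine.hasMajorant_thm314_combined` ∕ `B9Thm314ResolventTwoMetricWeighted.hasMajorant_resolvent_twoMetric_weighted` conclude
`HasMajorant blk T (fun a b => K₀·w(a)·e^{−σd(a,b)}·e^{−τF(a,b)})` over any `B6.Geometry`; at the transport `toB6 g R H` with the weight `w := [(Lʲη)², Lʲη,
Lʲη, 1]_n` this is `HasMajorantHom blk blk T (…)` by `B6RandomWalkHom.hasMajorantHom_iff`. [cite: Balaban1984PropagatorsII, (2.51) p.232 (bookkeeping)] -/
theorem hasMajorantHom_of_hasMajorant_entry {X : Type} {blk : X → g.Site} {T : Module.End ℝ (X → ℝ)} {n : Fin 4}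
    {K₀ σ τ : ℝ} {Fd : g.Site → g.Site → ℝ}
    (h : HasMajorant (g := toB6 g R H) blk T
      (fun a b => K₀ * B9.pref4 (g.len a) n * Real.exp (-(σ * g.dist a b)) * Real.exp (-(τ * Fd a b)))) :
    HasMajorantHom (g := toB6 g R H) blk blk T
      (fun a b => K₀ * B9.pref4 (g.len a) n * Real.exp (-(σ * g.dist a b)) * Real.exp (-(τ * Fd a b))) :=
  (hasMajorantHom_iff (g := toB6 g R H) blk T _).2 h

/-- **Halved rates are rates**: the combination step `B9Thm314Combine.hasMajorant_thm314_combined` outputs `√(CβC_R)·w(a)·e^{−(δ∕2)d}·e^{−(δ′∕2)F}`; read with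
`w := [(Lʲη)², Lʲη, Lʲη, 1]_n` it is the §2 kernel with `C := √(CβC_R)`, `δ₁ := δ∕2`, `δ₂ := δ′∕2` — a definitional re-lettering, recorded so the pin's
instantiation is a one-liner. [cite: Balaban1985BackgroundPropagators, Thm 3.14 p.427 («after adjusting a definition of δ₀»; bookkeeping)] -/
theorem hasMajorantHom_of_combined_shape {X : Type} {blk : X → g.Site} {T : Module.End ℝ (X → ℝ)} {n : Fin 4}
    {Cβ CR δ δ' : ℝ} {Fd : g.Site → g.Site → ℝ}
    (h : HasMajorant (g := toB6 g R H) blk T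
      (fun a b => Real.sqrt (Cβ * CR) * B9.pref4 (g.len a) n * Real.exp (-(δ / 2 * g.dist a b)) *
        Real.exp (-(δ' / 2 * Fd a b)))) :
    HasMajorantHom (g := toB6 g R H) blk blk T
      (fun a b => Real.sqrt (Cβ * CR) * B9.pref4 (g.len a) n * Real.exp (-((δ / 2) * g.dist a b)) *
        Real.exp (-((δ' / 2) * Fd a b))) :=
  (hasMajorantHom_iff (g := toB6 g R H) blk T _).2 h

end Shape

end Literature.MathematicalPhysics.QuantumFieldTheory.Balaban1983to89.B9Thm314SupReading
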